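import Summits.AtomisticToContinuum.HydrodynamicLimit.Theorems.RelayRaceLocalityNearConstantShortTimeHLAssemblyTheta
import Summits.AtomisticToContinuum.HydrodynamicLimit.Theorems.DenseExcursion.Negative.AthermalScaling
import HarnessLib

/-!
# Crux `NearConstantShortTimeHL` (stmt-AtomisticToContinuum-12502), line `small-tilt-domination`:
# stubs `momDefect_const_smul`, `enDefect_const_mul`

Linearity of the windowed weak-form closure defects `momDefect`, `enDefect`
(`…RelayRaceLocalityNearConstantShortTimeHLAssemblyTheta`) in the test field under constant
multiples: `momDefect … (c • ψ) = c · momDefect … ψ` and `enDefect … (c φ) = c · enDefect … φ`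
(lead c3, wave 2; used to pass between the `C¹`-normalised tests of the closure K-stubs and the raw
log-profile rows).

Route (folklore): every occurrence of the test in the two defects is linear — the empirical
momentum / energy fields tested against a function (Bochner integrals against the empirical
measure), the one-sided time derivative `Torus.timeDerivWithin` (a `derivWithin` over the field
`ℝ`, homogeneous without any differentiability hypothesis: `derivWithin_fun_const_smul_field`),
the partial derivatives / divergence / gradient (unconditional homogeneity, already in the tree:
`DenseExcursionAthermalScaling.partialDeriv_const_smul`, `….divergence_const_smul`,
`….gradient_const_mul`); then constants are pulled out of the finite sums, the space integral and
the time integral. In particular the identities hold for every real `c`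
(including `c = 0`) and use neither the positivity of the window length nor the smoothness of the
test.

No definitions, no named facts.
-/

noncomputable section

namespace Summit.AtomisticToContinuum.HydrodynamicLimit.Theorems.NearConstantShortTimeHL

open scoped BigOperators ENNReal
open MeasureTheory Set Filter
open Literature.MathematicalPhysics.KineticTheory Literature.Analysis.FluidPDE Literature.Analysis.FunctionSpaces

/-! ### Homogeneity of the one-sided time derivative in the test (no regularity needed) -/

/-- The one-sided time derivative is homogeneous: `∂ₜ (c • ψ) = c • ∂ₜ ψ` within any time set
(Mathlib `derivWithin_fun_const_smul_field`, no differentiability needed over a field). [folklore] -/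
theorem we_timeDerivWithin_const_smul {F' : Type*} [NormedAddCommGroup F'] [NormedSpace ℝ F']
    (S : Set ℝ) (c : ℝ) (ψ : ℝ → T3 → F') (r : ℝ) (y : T3) :
    Torus.timeDerivWithin S (fun r y => c • ψ r y) r y = c • Torus.timeDerivWithin S ψ r y := by
  simp only [Torus.timeDerivWithin]
  exact derivWithin_fun_const_smul_field c _

/-- The one-sided time derivative is homogeneous, scalar fields: `∂ₜ (c φ) = c ∂ₜ φ`. [folklore] -/
theorem we_timeDerivWithin_const_mul (S : Set ℝ) (c : ℝ) (φ : ℝ → T3 → ℝ) (r : ℝ) (y : T3) :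
    Torus.timeDerivWithin S (fun r y => c * φ r y) r y = c * Torus.timeDerivWithin S φ r y := by
  simp only [Torus.timeDerivWithin]
  exact derivWithin_const_mul_field c

/-- Function-level form of `we_timeDerivWithin_const_mul` (the time slice of `∂ₜ (c φ)`). [folklore] -/
theorem we_timeDerivWithin_const_mul_fun (S : Set ℝ) (c : ℝ) (φ : ℝ → T3 → ℝ) (r : ℝ) :
    Torus.timeDerivWithin S (fun r y => c * φ r y) r = fun y => c * Torus.timeDerivWithin S φ r y :=
  funext (we_timeDerivWithin_const_mul S c φ r)

/-! ### Homogeneity of the empirical fields in the test -/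

/-- The empirical momentum field is homogeneous in the test: `m_w[c χ] = c • m_w[χ]`. [folklore] -/
theorem we_empiricalMomentumField_const_mul {n : ℕ} (w : Config n (Fin 3) T3) (c : ℝ)
    (χ : T3 → ℝ) : empiricalMomentumField w (fun y => c * χ y) = c • empiricalMomentumField w χ := by
  simp only [empiricalMomentumField, mul_smul, integral_smul]

/-- The empirical energy field is homogeneous in the test: `e_w[c χ] = c e_w[χ]`. [folklore] -/
theorem we_empiricalEnergyField_const_mul {n : ℕ} (w : Config n (Fin 3) T3) (c : ℝ)
    (χ : T3 → ℝ) : empiricalEnergyField w (fun y => c * χ y) = c * empiricalEnergyField w χ := by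
  simp only [empiricalEnergyField, mul_assoc, integral_const_mul]

/-! ### The stubs -/

/-- **Registered stub `momDefect_const_smul`.** The windowed weak-form momentum closure defect is
homogeneous in the vector test: `momDefect σ Φ z ℓ s τ (c • ψ) = c · momDefect σ Φ z ℓ s τ ψ`
(every occurrence of `ψ` — boundary pairings, `∂ₜψ`, `∂ᵢψ`, `div ψ` — is linear; constants come
out of the finite sums and of the space and time integrals). [folklore] -/
theorem momDefect_const_smul : ∀ {σ ε : ℝ} {n : ℕ} (Φ : HardSphereFlow (Torus.geometry (Fin 3)) ε n) (z : Config n (Fin 3) T3) (ℓ : ℝ) {s τ : ℝ}, 0 < τ → ∀ {ψ : ℝ → T3 → V3}, Torus.IsSmoothSpaceTimeOn (Set.Icc s (s + τ)) ψ → ∀ c : ℝ, momDefect σ Φ z ℓ s τ (fun r y => c • ψ r y) = c * momDefect σ Φ z ℓ s τ ψ := by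
  intro σ ε n Φ z ℓ s τ _ ψ _ c
  simp only [momDefect]
  simp only [PiLp.smul_apply, smul_eq_mul, we_timeDerivWithin_const_smul,
    DenseExcursionAthermalScaling.partialDeriv_const_smul,
    DenseExcursionAthermalScaling.divergence_const_smul, we_empiricalMomentumField_const_mul]
  simp only [mul_assoc, mul_left_comm _ c, ← Finset.mul_sum, ← mul_add, ← mul_sub,
    integral_const_mul, intervalIntegral.integral_const_mul]

/-- **Registered stub `enDefect_const_mul`.** The windowed weak-form energy closure defect is
homogeneous in the scalar test: `enDefect σ Φ z ℓ s τ (c φ) = c · enDefect σ Φ z ℓ s τ φ`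
(every occurrence of `φ` — boundary pairings, `∂ₜφ`, `∇φ` — is linear). [folklore] -/
theorem enDefect_const_mul : ∀ {σ ε : ℝ} {n : ℕ} (Φ : HardSphereFlow (Torus.geometry (Fin 3)) ε n) (z : Config n (Fin 3) T3) (ℓ : ℝ) {s τ : ℝ}, 0 < τ → ∀ {φ : ℝ → T3 → ℝ}, Torus.IsSmoothSpaceTimeOn (Set.Icc s (s + τ)) φ → ∀ c : ℝ, enDefect σ Φ z ℓ s τ (fun r y => c * φ r y) = c * enDefect σ Φ z ℓ s τ φ := by
  intro σ ε n Φ z ℓ s τ _ φ _ c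
  simp only [enDefect]
  simp only [we_timeDerivWithin_const_mul_fun, DenseExcursionAthermalScaling.gradient_const_mul,
    we_empiricalEnergyField_const_mul, PiLp.smul_apply, smul_eq_mul]
  simp only [mul_left_comm _ c, ← Finset.mul_sum, ← mul_add, ← mul_sub, integral_const_mul,
    intervalIntegral.integral_const_mul]

end Summit.AtomisticToContinuum.HydrodynamicLimit.Theorems.NearConstantShortTimeHL

end
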